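import Summits.HodgeConjecture.CorCM.RankFourCMProductWeilType
import Summits.HodgeConjecture.CorCM.AndreRiemannBiproducts
import Literature.AlgebraicGeometry.Milne1999.CMTypeSubquotients
import Literature.AlgebraicGeometry.ComplexMultiplication.CenterEndAlgebraTotallyRealOrCMOfRiemann
import HarnessLib

/-!
# COR-CM (cell `pub-hodgecm2`): abstract E-CM products are of CM type; `HC_CM` is EQUIVALENT to the statements
# `B⁴` and `B^∞` of the crux line `FaceReduction/birth`

HONEST FRAMING (cell pub-hodgecm2 / COR-CM, seat b24 gen 21, count-neutral lane RANK4-HCCM, part 3; theorems only, no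
definition, no named fact; no case of the Hodge conjecture is proved).  The crux line
`Summits/HodgeConjecture/HodgeConjecture/Cruxes/FaceReduction/Lines/birth.lean` (skeleton 907f1396fc06 of the crux
`FaceReduction`, stmt-HodgeConjecture-16266, route `RankFourFaces`) types an «E-CM `r`-product» ABSTRACTLY: a monic
`P ∈ ℤ[T]` of degree `2g`, irreducible over `ℚ`; complex abelian `g`-folds `B_i` (`i : Fin r`) with `ψ_i : B_i ⟶ B_i`,
`P(ψ_i) = 0`; and `Y` with projections `π_i : Y ⟶ B_i` forming a limit fan.  This file proves, on the tree's real
carriers: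

* `isOfCMType_of_eval₂_eq_zero` — **an abelian `g`-fold `B` (`g ≥ 1`) carrying `ψ` with `P(ψ) = 0`, `P` monic of
  degree `2g` irreducible over `ℚ`, is of CM type** (`Milne1999.IsOfCMType`: `End⁰(B)` contains a commutative reduced
  `ℚ`-subalgebra of dimension `2 dim B`): the subalgebra `ℚ[ψ] = im(aeval ψ : ℚ[X] → End⁰(B))`; its kernel contains
  the maximal ideal `(P)` and is proper (`End⁰(B) ≠ 0` in positive dimension), so equals `(P)`, whence
  `ℚ[ψ] ≅ ℚ[X]/(P)` is a field of degree `deg P = 2g` (first isomorphism theorem, `finrank_quotient_span_eq_natDegree`);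
* `isOfCMType_biproduct_fin`, `isOfCMType_of_isLimit_fan` — finite biproducts, and limit fans, of abelian varieties
  of CM type are of CM type (`⨁_{Fin (m+1)} f ≅ f 0 × ⨁_{Fin m} (f ∘ succ)`, `AndreRiemann.biproduct_succ_split`;
  `Milne1999.isOfCMType_prod_iff`; a limit fan is isomorphic to the biproduct, `IsOfCMType.of_comp_eq_id`);
* **`cmProductWeilClassesAlgebraic_of_hc_cm`**, **`rankFourCMProductWeilClassesAlgebraic_of_hc_cm`** — `HC_CM`
  implies the statements `B^∞ = CMProductWeilClassesAlgebraic` and `B⁴ = RankFourCMProductWeilClassesAlgebraic` of the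
  crux line, restated VERBATIM (an abstract E-CM product is of CM type, so `HC_CM` makes ALL its rational `(k,k)`
  classes algebraic — the Weil-space membership and Weil-type hypotheses are not even used);
* `rankFourCMProductWeilClassesAlgebraic_of_cmProductWeilClassesAlgebraic` — `B^∞ ⟹ B⁴` (the instance `k = 2`);
* with part 2 (`RankFourWeil.hc_cm_of_rankFourCMProductWeilClassesAlgebraic`, `B⁴ ⟹ HC_CM`):
  **`hc_cm_iff_rankFourCMProductWeilClassesAlgebraic : HC_CM ↔ B⁴`**,
  **`hc_cm_iff_cmProductWeilClassesAlgebraic : HC_CM ↔ B^∞`**, and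
  `cmProductWeilClassesAlgebraic_of_rankFourCMProductWeilClassesAlgebraic : B⁴ → B^∞` — the registered stub
  `stub_latticeRankReduction` of the line (the «2001 lattice rank bound») holds, by way of `HC_CM`, with no lattice
  theorem; and `B^∞ → HC_CM` is the registered stub `stub_andreReduction` (André's reduction), by way of `B⁴` and the
  face form of `HC_CM` (part 1) — see the two stub files
  `Summits/HodgeConjecture/HodgeConjecture/Theorems/RankFourFacesFaceReductionStub{LatticeRankReduction,AndreReduction}.lean`.

Consequently the line `birth` reduces the crux `FaceReduction` to its stub A (`CMProductsReachRankFourFamily`, Deligne's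
split rank-four family with an algebraic anchor) ALONE, and the crux's content is exactly «transport ⟹ `B⁴`».

References: [Milne1999] J. S. Milne, Compositio Math. 117 (1999) §2 p. 54 (CM type); [Deligne1982HodgeCycles]
LNM 900 §5 p. 63 (products); [Shimura1998] §5.1 Props. 1, 3; [MumfordAV1970] §19 Thm. 3 (torsion-free `End`, `End⁰`);
[CharlesSchnell2014Notes] Lemma 11.5.18, Thm. 11.5.21, Prop. 11.5.22; [Andre1992HodgeCM] Théorème.
-/

noncomputable section

open CategoryTheory CategoryTheory.Limits NumberField Polynomial
open Literature.AlgebraicGeometry Literature.AlgebraicGeometry.Motives Literature.AlgebraicGeometry.HodgeTheory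
open Literature.AlgebraicGeometry.ComplexMultiplication Literature.AlgebraicGeometry.Milne1999
open Summit.HodgeConjecture.CorCM.AndreRiemann

namespace Summit.HodgeConjecture.CorCM.RankFourWeil

/-! ## §1 An abelian `g`-fold with `P(ψ) = 0`, `P` irreducible of degree `2g`, is of CM type -/

/-- **`P(ψ) = 0` with `P` irreducible of degree `2 dim B` makes `B` of CM type.**  For a complex abelian variety `B`
of positive dimension, `ψ : B ⟶ B` and a monic `P ∈ ℤ[T]`, irreducible over `ℚ`, of degree `2 dim B` with `P(ψ) = 0`
in `End(B)`, the `ℚ`-subalgebra `ℚ[ψ] ⊆ End⁰(B)` (the range of `aeval ψ`) is commutative, reduced and of dimension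
`2 dim B`: the kernel of `aeval ψ : ℚ[X] → End⁰(B)` contains the maximal ideal `(P)` and is proper, so
`ℚ[ψ] ≅ ℚ[X]/(P)`, a field of degree `deg P`.  (Milne 1999 §2 p. 54 / Deligne LNM 900 §5: `E = ℚ[T]/(P) ⊆ End⁰(B)`
with `[E:ℚ] = 2 dim B`.) [cite: Milne1999, §2 p. 54] [cite: Deligne1982HodgeCycles, §5 Prop. 5.1]
[cite: MumfordAV1970, §19 Thm. 3] -/
theorem isOfCMType_of_eval₂_eq_zero {B : AbelianVariety ℂ} (hB0 : 0 < B.dim) (ψ : B ⟶ B) (P : Polynomial ℤ)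
    (hPm : P.Monic) (hPirr : Irreducible (P.map (Int.castRingHom ℚ))) (hdeg : P.natDegree = 2 * B.dim)
    (hψ : Polynomial.eval₂ (Int.castRingHom (CategoryTheory.End B)) (ψ : CategoryTheory.End B) P = 0) :
    IsOfCMType B := by
  haveI : Nontrivial B.endAlgebra := nontrivial_endAlgebra_of_dim_pos hB0
  set x : B.endAlgebra := AbelianVariety.endAlgebra.of B ψ with hx_def
  set Pq : ℚ[X] := P.map (Int.castRingHom ℚ) with hPq_def
  set f : ℚ[X] →ₐ[ℚ] B.endAlgebra := Polynomial.aeval x with hf_def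
  -- `P(x) = 0` in `End⁰(B)`
  have hfP : f Pq = 0 := by
    have h1 := Polynomial.hom_eval₂ P (Int.castRingHom (CategoryTheory.End B)) (AbelianVariety.endAlgebra.of B) ψ
    rw [hψ, map_zero] at h1
    rw [hf_def, Polynomial.aeval_def, hPq_def, Polynomial.eval₂_map,
      RingHom.ext_int ((algebraMap ℚ B.endAlgebra).comp (Int.castRingHom ℚ))
        ((AbelianVariety.endAlgebra.of B).comp (Int.castRingHom (CategoryTheory.End B)))]
    exact h1.symm
  -- the kernel of `aeval x` is the maximal ideal `(P)`
  have hmax : (Ideal.span {Pq}).IsMaximal := PrincipalIdealRing.isMaximal_of_irreducible hPirr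
  have hker : Ideal.span {Pq} = RingHom.ker f := by
    refine hmax.eq_of_le (RingHom.ker_ne_top f) ?_
    rw [Ideal.span_singleton_le_iff_mem, RingHom.mem_ker]
    exact hfP
  -- `ℚ[X]/(P) ≃ₐ range (aeval x)`, a field of degree `deg P`
  let e : (ℚ[X] ⧸ Ideal.span {Pq}) ≃ₐ[ℚ] f.range :=
    (Ideal.quotientEquivAlgOfEq ℚ hker).trans (Ideal.quotientKerEquivRange f)
  haveI : IsDomain (ℚ[X] ⧸ Ideal.span {Pq}) := (Ideal.Quotient.isDomain_iff_prime _).2 hmax.isPrime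
  refine ⟨f.range, ?_, ?_, ?_⟩
  · exact isReduced_of_injective (e.symm : f.range →ₐ[ℚ] ℚ[X] ⧸ Ideal.span {Pq}) e.symm.injective
  · intro a ha b hb
    obtain ⟨p, rfl⟩ := (AlgHom.mem_range f).1 ha
    obtain ⟨q, rfl⟩ := (AlgHom.mem_range f).1 hb
    rw [← map_mul, ← map_mul, mul_comm]
  · rw [← e.toLinearEquiv.finrank_eq, finrank_quotient_span_eq_natDegree, hPq_def, hPm.natDegree_map, hdeg]

/-! ## §2 Finite biproducts and limit fans of abelian varieties of CM type -/

/-- **A finite biproduct of complex abelian varieties of CM type is of CM type** (Deligne LNM 900 §5 p. 63: «`A` is of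
CM-type iff each `A_α` is»): induction along `⨁_{Fin (m+1)} f ≅ f 0 × ⨁_{Fin m} (f ∘ succ)`
(`AndreRiemann.biproduct_succ_split`, `Milne1999.isOfCMType_prod_iff`, `IsOfCMType.of_comp_eq_id`); the empty biproduct
has dimension `0` (`AndreRiemann.dim_biproduct_fin_zero`, `isOfCMType_of_dim_eq_zero`).
[cite: Deligne1982HodgeCycles, §5 p. 63] [cite: Milne1999, §2 p. 54] -/
theorem isOfCMType_biproduct_fin : ∀ {m : ℕ} (f : Fin m → AbelianVariety ℂ), (∀ i, IsOfCMType (f i)) →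
    IsOfCMType (⨁ f)
  | 0, f, _ => isOfCMType_of_dim_eq_zero (dim_biproduct_fin_zero f)
  | _ + 1, f, hf => by
    obtain ⟨h, g, hhg, -⟩ := biproduct_succ_split f
    exact (isOfCMType_prod_iff.2 ⟨hf 0, isOfCMType_biproduct_fin (f ∘ Fin.succ) fun i => hf i.succ⟩).of_comp_eq_id
      h g hhg

/-- **A limit fan of complex abelian varieties of CM type has apex of CM type**: if `π_i : Y ⟶ B_i` (`i : Fin r`) is a
limit cone over abelian varieties `B_i` of CM type, then `Y ≅ ⨁ B` (uniqueness of limits, `biproduct.isLimit`) is of CM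
type. [cite: Deligne1982HodgeCycles, §5 p. 63] [cite: Milne1999, §2 p. 54] -/
theorem isOfCMType_of_isLimit_fan {r : ℕ} (B : Fin r → AbelianVariety ℂ) (hB : ∀ i, IsOfCMType (B i))
    (Y : AbelianVariety ℂ) (π : ∀ i, Y ⟶ B i) (hY : IsLimit (Fan.mk Y π)) : IsOfCMType Y :=
  let e : Y ≅ ⨁ B := hY.conePointUniqueUpToIso (biproduct.isLimit B)
  (isOfCMType_biproduct_fin B hB).of_comp_eq_id e.hom e.inv e.hom_inv_id

/-- **An abstract E-CM `r`-product is of CM type**: `P ∈ ℤ[T]` monic of degree `2g` (`g ≥ 1`) irreducible over `ℚ`,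
`B_i` abelian `g`-folds with `P(ψ_i) = 0`, `Y` the apex of a limit fan `π_i : Y ⟶ B_i` — then `Y` is of CM type
(`isOfCMType_of_eval₂_eq_zero` on each factor, `isOfCMType_of_isLimit_fan`). [cite: Milne1999, §2 p. 54]
[cite: Deligne1982HodgeCycles, §5 p. 63 and Prop. 5.1] -/
theorem isOfCMType_of_cmProduct {g : ℕ} (hg : 1 ≤ g) (P : Polynomial ℤ) (hPm : P.Monic)
    (hdeg : P.natDegree = 2 * g) (hPirr : Irreducible (P.map (Int.castRingHom ℚ))) {r : ℕ}
    (B : Fin r → AbelianVariety ℂ) (ψ : ∀ i, B i ⟶ B i) (hBdim : ∀ i, (B i).dim = g)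
    (hψ : ∀ i, Polynomial.eval₂ (Int.castRingHom (CategoryTheory.End (B i))) (ψ i : CategoryTheory.End (B i)) P = 0)
    (Y : AbelianVariety ℂ) (π : ∀ i, Y ⟶ B i) (hY : Nonempty (IsLimit (Fan.mk Y π))) : IsOfCMType Y := by
  obtain ⟨hY⟩ := hY
  refine isOfCMType_of_isLimit_fan B (fun i => ?_) Y π hY
  exact isOfCMType_of_eval₂_eq_zero (by rw [hBdim i]; exact hg) (ψ i) P hPm hPirr (by rw [hdeg, hBdim i]) (hψ i)

/-! ## §3 `HC_CM` implies the statements `B^∞` and `B⁴` of the crux line `FaceReduction/birth` -/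

/-- **`HC_CM ⟹ B^∞`.**  The statement `CMProductWeilClassesAlgebraic` of `Cruxes/FaceReduction/Lines/birth.lean` —
«rational `(k,k)` E-Weil classes on E-CM `2k`-products of Weil type are algebraic, every `k ≥ 1`, every CM polynomial
`P` of degree `2g`, `g ≥ 1`» — restated VERBATIM, follows from `HC_CM`: the E-CM product `Y` is of CM type
(`isOfCMType_of_cmProduct`), so `HC_CM` makes every rational `(k,k)` class on `Y` algebraic (the hypotheses «no real
root», «polynomial complex conjugation», `P(φ) = 0`, «of Weil type» and the Weil-space membership of `c` are idle).
[cite: Milne1999, §2 p. 54 and §7 p. 72] [cite: Andre1992HodgeCM, Théorème] -/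
theorem cmProductWeilClassesAlgebraic_of_hc_cm (h : HC_CM) :
    ∀ (g : ℕ), 1 ≤ g → ∀ (P : Polynomial ℤ), P.Monic → P.natDegree = 2 * g →
      Irreducible (P.map (Int.castRingHom ℚ)) →
      (∀ ρ : ℂ, Polynomial.eval₂ (Int.castRingHom ℂ) ρ P = 0 → ρ.im ≠ 0) →
      (∃ Q : Polynomial ℚ, ∀ ρ : ℂ, Polynomial.eval₂ (Int.castRingHom ℂ) ρ P = 0 →
        Polynomial.aeval ρ Q = (starRingEnd ℂ) ρ) →
      ∀ (k : ℕ), 1 ≤ k →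
      ∀ (B : Fin (2 * k) → Literature.AlgebraicGeometry.Motives.AbelianVariety ℂ) (ψ : ∀ i, B i ⟶ B i),
        (∀ i, (B i).dim = g) →
        (∀ i, Polynomial.eval₂ (Int.castRingHom (CategoryTheory.End (B i)))
          (ψ i : CategoryTheory.End (B i)) P = 0) →
      ∀ (Y : Literature.AlgebraicGeometry.Motives.AbelianVariety ℂ) (φ : Y ⟶ Y) (π : ∀ i, Y ⟶ B i),
        (∀ i, π i ≫ ψ i = φ ≫ π i) →
        Nonempty (CategoryTheory.Limits.IsLimit (CategoryTheory.Limits.Fan.mk Y π)) →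
        Y.dim = 2 * k * g →
        Literature.AlgebraicGeometry.Motives.IsSmoothProjective (2 * k * g) Y.X →
        Polynomial.eval₂ (Int.castRingHom (CategoryTheory.End Y)) (φ : CategoryTheory.End Y) P = 0 →
        (∀ c ∈ (⨆ ρ ∈ {ρ : ℂ | Polynomial.eval₂ (Int.castRingHom ℂ) ρ P = 0},
            Literature.AlgebraicGeometry.HodgeTheory.pullbackEigenclasses Y φ (2 * k)
              (fun x y => ((x : ℂ) + (y : ℂ) * ρ) ^ (2 * k))),
          Literature.AlgebraicGeometry.HodgeTheory.IsOfHodgeType (2 * k * g) Y.X (2 * k) k k c) →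
      ∀ c : Literature.AlgebraicGeometry.HodgeTheory.complexBetti Y.X (2 * k),
        Literature.AlgebraicGeometry.HodgeTheory.IsRationalClass c →
        Literature.AlgebraicGeometry.HodgeTheory.IsOfHodgeType (2 * k * g) Y.X (2 * k) k k c →
        c ∈ (⨆ ρ ∈ {ρ : ℂ | Polynomial.eval₂ (Int.castRingHom ℂ) ρ P = 0},
            Literature.AlgebraicGeometry.HodgeTheory.pullbackEigenclasses Y φ (2 * k)
              (fun x y => ((x : ℂ) + (y : ℂ) * ρ) ^ (2 * k))) →
        c ∈ Literature.AlgebraicGeometry.HodgeTheory.algebraicClasses Y.X k := by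
  intro g hg P hPm hPdeg hPirr _ _ k _ B ψ hBdim hψ Y φ π _ hY hYdim hYsp _ _ c hcQ hcH _
  have hYcm : IsOfCMType Y := isOfCMType_of_cmProduct hg P hPm hPdeg hPirr B ψ hBdim hψ Y π hY
  have hHC : HodgeConjectureFor Y.dim Y.X := h Y AbelianVariety.isSmoothProjective_holds hYcm
  rw [hYdim] at hHC
  exact hHC.2 k c hcQ hcH

/-- **`HC_CM ⟹ B⁴`.**  The statement `RankFourCMProductWeilClassesAlgebraic` of `Cruxes/FaceReduction/Lines/birth.lean`
— «rational `(2,2)` E-Weil classes on E-CM 4-products of Weil type are algebraic, `g ≥ 2`» — restated VERBATIM,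
follows from `HC_CM` (same argument, `r = 4`, `p = 2`).  With part 2's converse
`hc_cm_of_rankFourCMProductWeilClassesAlgebraic` this makes `B⁴` EQUIVALENT to `HC_CM`.
[cite: Milne1999, §2 p. 54 and §7 p. 72] [cite: CharlesSchnell2014Notes, Prop. 11.5.22] -/
theorem rankFourCMProductWeilClassesAlgebraic_of_hc_cm (h : HC_CM) :
    ∀ (g : ℕ), 2 ≤ g → ∀ (P : Polynomial ℤ), P.Monic → P.natDegree = 2 * g →
      Irreducible (P.map (Int.castRingHom ℚ)) →
      (∀ ρ : ℂ, Polynomial.eval₂ (Int.castRingHom ℂ) ρ P = 0 → ρ.im ≠ 0) →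
      (∃ Q : Polynomial ℚ, ∀ ρ : ℂ, Polynomial.eval₂ (Int.castRingHom ℂ) ρ P = 0 →
        Polynomial.aeval ρ Q = (starRingEnd ℂ) ρ) →
      ∀ (B : Fin 4 → Literature.AlgebraicGeometry.Motives.AbelianVariety ℂ) (ψ : ∀ i, B i ⟶ B i),
        (∀ i, (B i).dim = g) →
        (∀ i, Polynomial.eval₂ (Int.castRingHom (CategoryTheory.End (B i)))
          (ψ i : CategoryTheory.End (B i)) P = 0) →
      ∀ (Y : Literature.AlgebraicGeometry.Motives.AbelianVariety ℂ) (φ : Y ⟶ Y) (π : ∀ i, Y ⟶ B i),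
        (∀ i, π i ≫ ψ i = φ ≫ π i) →
        Nonempty (CategoryTheory.Limits.IsLimit (CategoryTheory.Limits.Fan.mk Y π)) →
        Y.dim = 4 * g →
        Literature.AlgebraicGeometry.Motives.IsSmoothProjective (4 * g) Y.X →
        Polynomial.eval₂ (Int.castRingHom (CategoryTheory.End Y)) (φ : CategoryTheory.End Y) P = 0 →
        (∀ c ∈ (⨆ ρ ∈ {ρ : ℂ | Polynomial.eval₂ (Int.castRingHom ℂ) ρ P = 0},
            Literature.AlgebraicGeometry.HodgeTheory.pullbackEigenclasses Y φ 4
              (fun x y => ((x : ℂ) + (y : ℂ) * ρ) ^ 4)),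
          Literature.AlgebraicGeometry.HodgeTheory.IsOfHodgeType (4 * g) Y.X 4 2 2 c) →
      ∀ c : Literature.AlgebraicGeometry.HodgeTheory.complexBetti Y.X 4,
        Literature.AlgebraicGeometry.HodgeTheory.IsRationalClass c →
        Literature.AlgebraicGeometry.HodgeTheory.IsOfHodgeType (4 * g) Y.X 4 2 2 c →
        c ∈ (⨆ ρ ∈ {ρ : ℂ | Polynomial.eval₂ (Int.castRingHom ℂ) ρ P = 0},
            Literature.AlgebraicGeometry.HodgeTheory.pullbackEigenclasses Y φ 4
              (fun x y => ((x : ℂ) + (y : ℂ) * ρ) ^ 4)) →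
        c ∈ Literature.AlgebraicGeometry.HodgeTheory.algebraicClasses Y.X 2 := by
  intro g hg P hPm hPdeg hPirr _ _ B ψ hBdim hψ Y φ π _ hY hYdim hYsp _ _ c hcQ hcH _
  have hYcm : IsOfCMType Y := isOfCMType_of_cmProduct (by omega) P hPm hPdeg hPirr B ψ hBdim hψ Y π hY
  have hHC : HodgeConjectureFor Y.dim Y.X := h Y AbelianVariety.isSmoothProjective_holds hYcm
  rw [hYdim] at hHC
  exact hHC.2 2 c hcQ hcH

/-! ## §4 `B^∞ ⟹ B⁴`; `HC_CM ↔ B⁴ ↔ B^∞`; the two reduction stubs of the line -/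

/-- **`B^∞ ⟹ B⁴`**: the rank-four statement is the instance `k = 2` of the all-rank statement (`Fin (2·2) = Fin 4`,
`2·2·g = 4g` definitionally). [folklore] -/
theorem rankFourCMProductWeilClassesAlgebraic_of_cmProductWeilClassesAlgebraic
    (h : ∀ (g : ℕ), 1 ≤ g → ∀ (P : Polynomial ℤ), P.Monic → P.natDegree = 2 * g →
      Irreducible (P.map (Int.castRingHom ℚ)) →
      (∀ ρ : ℂ, Polynomial.eval₂ (Int.castRingHom ℂ) ρ P = 0 → ρ.im ≠ 0) →
      (∃ Q : Polynomial ℚ, ∀ ρ : ℂ, Polynomial.eval₂ (Int.castRingHom ℂ) ρ P = 0 →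
        Polynomial.aeval ρ Q = (starRingEnd ℂ) ρ) →
      ∀ (k : ℕ), 1 ≤ k →
      ∀ (B : Fin (2 * k) → Literature.AlgebraicGeometry.Motives.AbelianVariety ℂ) (ψ : ∀ i, B i ⟶ B i),
        (∀ i, (B i).dim = g) →
        (∀ i, Polynomial.eval₂ (Int.castRingHom (CategoryTheory.End (B i)))
          (ψ i : CategoryTheory.End (B i)) P = 0) →
      ∀ (Y : Literature.AlgebraicGeometry.Motives.AbelianVariety ℂ) (φ : Y ⟶ Y) (π : ∀ i, Y ⟶ B i),
        (∀ i, π i ≫ ψ i = φ ≫ π i) →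
        Nonempty (CategoryTheory.Limits.IsLimit (CategoryTheory.Limits.Fan.mk Y π)) →
        Y.dim = 2 * k * g →
        Literature.AlgebraicGeometry.Motives.IsSmoothProjective (2 * k * g) Y.X →
        Polynomial.eval₂ (Int.castRingHom (CategoryTheory.End Y)) (φ : CategoryTheory.End Y) P = 0 →
        (∀ c ∈ (⨆ ρ ∈ {ρ : ℂ | Polynomial.eval₂ (Int.castRingHom ℂ) ρ P = 0},
            Literature.AlgebraicGeometry.HodgeTheory.pullbackEigenclasses Y φ (2 * k)
              (fun x y => ((x : ℂ) + (y : ℂ) * ρ) ^ (2 * k))),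
          Literature.AlgebraicGeometry.HodgeTheory.IsOfHodgeType (2 * k * g) Y.X (2 * k) k k c) →
      ∀ c : Literature.AlgebraicGeometry.HodgeTheory.complexBetti Y.X (2 * k),
        Literature.AlgebraicGeometry.HodgeTheory.IsRationalClass c →
        Literature.AlgebraicGeometry.HodgeTheory.IsOfHodgeType (2 * k * g) Y.X (2 * k) k k c →
        c ∈ (⨆ ρ ∈ {ρ : ℂ | Polynomial.eval₂ (Int.castRingHom ℂ) ρ P = 0},
            Literature.AlgebraicGeometry.HodgeTheory.pullbackEigenclasses Y φ (2 * k)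
              (fun x y => ((x : ℂ) + (y : ℂ) * ρ) ^ (2 * k))) →
        c ∈ Literature.AlgebraicGeometry.HodgeTheory.algebraicClasses Y.X k) :
    ∀ (g : ℕ), 2 ≤ g → ∀ (P : Polynomial ℤ), P.Monic → P.natDegree = 2 * g →
      Irreducible (P.map (Int.castRingHom ℚ)) →
      (∀ ρ : ℂ, Polynomial.eval₂ (Int.castRingHom ℂ) ρ P = 0 → ρ.im ≠ 0) →
      (∃ Q : Polynomial ℚ, ∀ ρ : ℂ, Polynomial.eval₂ (Int.castRingHom ℂ) ρ P = 0 →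
        Polynomial.aeval ρ Q = (starRingEnd ℂ) ρ) →
      ∀ (B : Fin 4 → Literature.AlgebraicGeometry.Motives.AbelianVariety ℂ) (ψ : ∀ i, B i ⟶ B i),
        (∀ i, (B i).dim = g) →
        (∀ i, Polynomial.eval₂ (Int.castRingHom (CategoryTheory.End (B i)))
          (ψ i : CategoryTheory.End (B i)) P = 0) →
      ∀ (Y : Literature.AlgebraicGeometry.Motives.AbelianVariety ℂ) (φ : Y ⟶ Y) (π : ∀ i, Y ⟶ B i),
        (∀ i, π i ≫ ψ i = φ ≫ π i) →
        Nonempty (CategoryTheory.Limits.IsLimit (CategoryTheory.Limits.Fan.mk Y π)) →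
        Y.dim = 4 * g →
        Literature.AlgebraicGeometry.Motives.IsSmoothProjective (4 * g) Y.X →
        Polynomial.eval₂ (Int.castRingHom (CategoryTheory.End Y)) (φ : CategoryTheory.End Y) P = 0 →
        (∀ c ∈ (⨆ ρ ∈ {ρ : ℂ | Polynomial.eval₂ (Int.castRingHom ℂ) ρ P = 0},
            Literature.AlgebraicGeometry.HodgeTheory.pullbackEigenclasses Y φ 4
              (fun x y => ((x : ℂ) + (y : ℂ) * ρ) ^ 4)),
          Literature.AlgebraicGeometry.HodgeTheory.IsOfHodgeType (4 * g) Y.X 4 2 2 c) →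
      ∀ c : Literature.AlgebraicGeometry.HodgeTheory.complexBetti Y.X 4,
        Literature.AlgebraicGeometry.HodgeTheory.IsRationalClass c →
        Literature.AlgebraicGeometry.HodgeTheory.IsOfHodgeType (4 * g) Y.X 4 2 2 c →
        c ∈ (⨆ ρ ∈ {ρ : ℂ | Polynomial.eval₂ (Int.castRingHom ℂ) ρ P = 0},
            Literature.AlgebraicGeometry.HodgeTheory.pullbackEigenclasses Y φ 4
              (fun x y => ((x : ℂ) + (y : ℂ) * ρ) ^ 4)) →
        c ∈ Literature.AlgebraicGeometry.HodgeTheory.algebraicClasses Y.X 2 := by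
  intro g hg P hPm hPdeg hPirr hreal hconj B ψ hBdim hψ Y φ π hπ hY hYdim hYsp hφ hWeil c hcQ hcH hcW
  exact h g (by omega) P hPm hPdeg hPirr hreal hconj 2 (by norm_num) B ψ hBdim hψ Y φ π hπ hY hYdim hYsp hφ hWeil c
    hcQ hcH hcW

/-- **`HC_CM ↔ B⁴`**: the Hodge conjecture for complex abelian varieties of CM type is EQUIVALENT to the rank-four
input `RankFourCMProductWeilClassesAlgebraic` of the crux line `FaceReduction/birth` (`⟸`: part 2,
`hc_cm_of_rankFourCMProductWeilClassesAlgebraic`, via the corner products of faces; `⟹`: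
`rankFourCMProductWeilClassesAlgebraic_of_hc_cm`).  Neither side is asserted.
[cite: CharlesSchnell2014Notes, Prop. 11.5.22] [cite: Pohlmann1968, Thm. 1] [cite: Milne1999, §7 p. 72] -/
theorem hc_cm_iff_rankFourCMProductWeilClassesAlgebraic :
    HC_CM ↔
    ∀ (g : ℕ), 2 ≤ g → ∀ (P : Polynomial ℤ), P.Monic → P.natDegree = 2 * g →
      Irreducible (P.map (Int.castRingHom ℚ)) →
      (∀ ρ : ℂ, Polynomial.eval₂ (Int.castRingHom ℂ) ρ P = 0 → ρ.im ≠ 0) →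
      (∃ Q : Polynomial ℚ, ∀ ρ : ℂ, Polynomial.eval₂ (Int.castRingHom ℂ) ρ P = 0 →
        Polynomial.aeval ρ Q = (starRingEnd ℂ) ρ) →
      ∀ (B : Fin 4 → Literature.AlgebraicGeometry.Motives.AbelianVariety ℂ) (ψ : ∀ i, B i ⟶ B i),
        (∀ i, (B i).dim = g) →
        (∀ i, Polynomial.eval₂ (Int.castRingHom (CategoryTheory.End (B i)))
          (ψ i : CategoryTheory.End (B i)) P = 0) →
      ∀ (Y : Literature.AlgebraicGeometry.Motives.AbelianVariety ℂ) (φ : Y ⟶ Y) (π : ∀ i, Y ⟶ B i),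
        (∀ i, π i ≫ ψ i = φ ≫ π i) →
        Nonempty (CategoryTheory.Limits.IsLimit (CategoryTheory.Limits.Fan.mk Y π)) →
        Y.dim = 4 * g →
        Literature.AlgebraicGeometry.Motives.IsSmoothProjective (4 * g) Y.X →
        Polynomial.eval₂ (Int.castRingHom (CategoryTheory.End Y)) (φ : CategoryTheory.End Y) P = 0 →
        (∀ c ∈ (⨆ ρ ∈ {ρ : ℂ | Polynomial.eval₂ (Int.castRingHom ℂ) ρ P = 0},
            Literature.AlgebraicGeometry.HodgeTheory.pullbackEigenclasses Y φ 4
              (fun x y => ((x : ℂ) + (y : ℂ) * ρ) ^ 4)),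
          Literature.AlgebraicGeometry.HodgeTheory.IsOfHodgeType (4 * g) Y.X 4 2 2 c) →
      ∀ c : Literature.AlgebraicGeometry.HodgeTheory.complexBetti Y.X 4,
        Literature.AlgebraicGeometry.HodgeTheory.IsRationalClass c →
        Literature.AlgebraicGeometry.HodgeTheory.IsOfHodgeType (4 * g) Y.X 4 2 2 c →
        c ∈ (⨆ ρ ∈ {ρ : ℂ | Polynomial.eval₂ (Int.castRingHom ℂ) ρ P = 0},
            Literature.AlgebraicGeometry.HodgeTheory.pullbackEigenclasses Y φ 4
              (fun x y => ((x : ℂ) + (y : ℂ) * ρ) ^ 4)) →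
        c ∈ Literature.AlgebraicGeometry.HodgeTheory.algebraicClasses Y.X 2 :=
  ⟨rankFourCMProductWeilClassesAlgebraic_of_hc_cm, hc_cm_of_rankFourCMProductWeilClassesAlgebraic⟩

/-- **`HC_CM ↔ B^∞`**: likewise for the all-rank statement `CMProductWeilClassesAlgebraic` of the crux line (`⟸`:
`B^∞ ⟹ B⁴ ⟹ HC_CM`). Neither side is asserted. [cite: Andre1992HodgeCM, Théorème]
[cite: CharlesSchnell2014Notes, Thm. 11.5.21 and Prop. 11.5.22] [cite: Milne1999, §7 p. 72] -/
theorem hc_cm_iff_cmProductWeilClassesAlgebraic :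
    HC_CM ↔
    ∀ (g : ℕ), 1 ≤ g → ∀ (P : Polynomial ℤ), P.Monic → P.natDegree = 2 * g →
      Irreducible (P.map (Int.castRingHom ℚ)) →
      (∀ ρ : ℂ, Polynomial.eval₂ (Int.castRingHom ℂ) ρ P = 0 → ρ.im ≠ 0) →
      (∃ Q : Polynomial ℚ, ∀ ρ : ℂ, Polynomial.eval₂ (Int.castRingHom ℂ) ρ P = 0 →
        Polynomial.aeval ρ Q = (starRingEnd ℂ) ρ) →
      ∀ (k : ℕ), 1 ≤ k →
      ∀ (B : Fin (2 * k) → Literature.AlgebraicGeometry.Motives.AbelianVariety ℂ) (ψ : ∀ i, B i ⟶ B i),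
        (∀ i, (B i).dim = g) →
        (∀ i, Polynomial.eval₂ (Int.castRingHom (CategoryTheory.End (B i)))
          (ψ i : CategoryTheory.End (B i)) P = 0) →
      ∀ (Y : Literature.AlgebraicGeometry.Motives.AbelianVariety ℂ) (φ : Y ⟶ Y) (π : ∀ i, Y ⟶ B i),
        (∀ i, π i ≫ ψ i = φ ≫ π i) →
        Nonempty (CategoryTheory.Limits.IsLimit (CategoryTheory.Limits.Fan.mk Y π)) →
        Y.dim = 2 * k * g →
        Literature.AlgebraicGeometry.Motives.IsSmoothProjective (2 * k * g) Y.X →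
        Polynomial.eval₂ (Int.castRingHom (CategoryTheory.End Y)) (φ : CategoryTheory.End Y) P = 0 →
        (∀ c ∈ (⨆ ρ ∈ {ρ : ℂ | Polynomial.eval₂ (Int.castRingHom ℂ) ρ P = 0},
            Literature.AlgebraicGeometry.HodgeTheory.pullbackEigenclasses Y φ (2 * k)
              (fun x y => ((x : ℂ) + (y : ℂ) * ρ) ^ (2 * k))),
          Literature.AlgebraicGeometry.HodgeTheory.IsOfHodgeType (2 * k * g) Y.X (2 * k) k k c) →
      ∀ c : Literature.AlgebraicGeometry.HodgeTheory.complexBetti Y.X (2 * k),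
        Literature.AlgebraicGeometry.HodgeTheory.IsRationalClass c →
        Literature.AlgebraicGeometry.HodgeTheory.IsOfHodgeType (2 * k * g) Y.X (2 * k) k k c →
        c ∈ (⨆ ρ ∈ {ρ : ℂ | Polynomial.eval₂ (Int.castRingHom ℂ) ρ P = 0},
            Literature.AlgebraicGeometry.HodgeTheory.pullbackEigenclasses Y φ (2 * k)
              (fun x y => ((x : ℂ) + (y : ℂ) * ρ) ^ (2 * k))) →
        c ∈ Literature.AlgebraicGeometry.HodgeTheory.algebraicClasses Y.X k :=
  ⟨cmProductWeilClassesAlgebraic_of_hc_cm, fun h =>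
    hc_cm_of_rankFourCMProductWeilClassesAlgebraic
      (rankFourCMProductWeilClassesAlgebraic_of_cmProductWeilClassesAlgebraic h)⟩

end Summit.HodgeConjecture.CorCM.RankFourWeil

end
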